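import Summits.ResolutionOfSingularities.ResolutionOfSingularities.Theorems.TauChainLaw
import HarnessLib

/-!
# TauChainLaw2 — decomp-res node «TauChainCut» (lens-4 g32 REV 2, critic row 186 CLEARED DECIDED +1 · MAP 0), tree
file 2/5 of the node

Content VERBATIM from the decomp-res lens-4 g32 node REV 2 `HOME/decomp-res-lens-4/g32/TauChainCut_rev2.lean` (pin
d70c0cc0; imports the landed tree only, carries nothing); HOME = run/shared/lean/pub/decomp-res; critic row 186
CLEARED DECIDED +1 · MAP 0; landing orders INBOX :984/:996 — provenance, critic text and the lens header in full in
the first file of the node, `TauChainLaw`.  Namespace `…Theorems.HugValuationCut`; `--supports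
stmt-ResolutionOfSingularities-28338`.

## This file

Continuation 2/2 of `TauChainLaw` (same sections of the node, cut at the 400-line cap): carries
`planeConeAt_of_stalkTau_eq_one`, `planeConeAt_of_towerTau_eq_one`, `planeConeTower_of_tauOneTower`,
`noTower_threefold_not_planeCone`, `CurveLikeTower`, `noTower_threefold_curveLike`, `noTowerWild_threefold_curveLike`.

[WRITER NOTE (decomp-res writer g12): file split only (tree files ≤ 400 lines); namespace, sections, section
variables / opens and every declaration exactly as in the lens (the node's global dupNamespace-linter line is
dropped — the library sets it; the `open …Theses` line lives only in the Theses-cone file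
`MaxContactCutTauChainCut`; the lens's cone imports `MaxContactCutSatelliteCut` / `MaxContactCutWallCutCells` /
`MaxContactCutSurfacePort` are confined to the cone file, the cone-free files import `SurfacePort` /
`SurfacePortCells` (⊇ the Wall / History / Depth cut cells they open) per rider (1)–(2)).]

(Sources: Hironaka1964 Ch. III (τ, directrix); Hironaka1970 / Giraud1975 (near points, τ-monotonicity);
CossartJannsenSaito2020 Thm. 6.40, Def. 6.38–6.39, Thm. 6.35 / Cor. 6.37, Ch. 8; Hauser2010Kangaroo;
HauserPerlega2019 §2; CossartPiltant2008 §2; CossartPiltant2019; Hironaka2005; Matsumura1987 §28; StacksProject 0804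
/ 0BIQ / 031I.)
-/

noncomputable section

open CategoryTheory AlgebraicGeometry IsLocalRing TopologicalSpace
open Literature.AlgebraicGeometry.Resolution
open Summit.ResolutionOfSingularities.ResolutionOfSingularities.Theorems
open WeakOrderReduction ForcedTowerClasses DivergentTowerClasses MonomialTowerClasses
open HugDimensionClasses HugDimensionKernels SurfaceShadowClasses SurfaceShadowKernels
open NearPointCut (SingularClass)
open Scheme.IdealSheafData (vanishingIdeal)
open scoped BigOperators

namespace Summit.ResolutionOfSingularities.ResolutionOfSingularities.Theorems.HugValuationCut

section TauOneCone

open MvPolynomial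

/-! ## §94 (g32 · NEW · KERNEL) KERNEL B — `τ = 1` IN EMBEDDING DIMENSION 3 IS A RATIONAL PLANE CONE (every ideal,
principal or not)

At a point `y` with `𝒪_y` regular of embedding dimension 3, `ord_y 𝓘 = n ≥ 1` and `τ_y(𝓘, n) = 1`: Cossart–Piltant's
adapted regular
system `(z, u₁, u₂)` (tree `exists_rsop_forall_ne_zero_isAdapted_of_stalkTau_eq_one`) has EVERY degree-`n` initial form of `𝓘_y`
equal to `a·Z^n` (`forall_initialForms_eq_C_mul_X_pow_of_isAdapted`); an element `f ∈ 𝓘_y ∖ 𝔪^{n+1}` (it exists: the order is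
exactly `n`) is `F(z, u₁, u₂)` for a form `F` of degree `n` (`exists_isHomogeneous_eval_eq_of_mem_pow`) with `F̄ = ā·Z^n`, so
`f − a·z^n ∈ 𝔪^{n+1}` (`eval_mem_pow_succ_of_map_residue_eq_zero`), and `a` is a unit and `z ∉ 𝔪²` because `f ∉ 𝔪^{n+1}`:
`PlaneConeAt 𝓘 n y`. -/

/-- **KERNEL B (PROVED): `τ = 1` at a point of embedding dimension 3 and order exactly `n ≥ 1` ⇒ `PlaneConeAt`.**
(Sources: CossartPiltant2008, Lemma 4.3 (5) (proof, p. 9), Prop. 4.4 (proof, p. 11); CossartJannsenSaito2020, Def. 6.38 (i).) -/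
theorem planeConeAt_of_stalkTau_eq_one {Y : Scheme.{0}} (I : Y.IdealSheafData) {n : ℕ} (hn : 1 ≤ n) (y : Y)
    [IsRegularLocalRing (Y.presheaf.stalk y)] (hd : (maximalIdeal (Y.presheaf.stalk y)).spanFinrank = 3)
    (hord : idealOrder I y = ((n : ℕ) : ℕ∞)) (hτ : stalkTau I y n = 1) : PlaneConeAt I n y := by
  classical
  have hle : stalkIdeal I y ≤ maximalIdeal (Y.presheaf.stalk y) ^ n := (le_idealOrder_iff I y n).mp hord.ge
  have hnle : ¬ stalkIdeal I y ≤ maximalIdeal (Y.presheaf.stalk y) ^ (n + 1) := by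
    rw [← le_idealOrder_iff, hord]
    exact_mod_cast Nat.not_succ_le_self n
  obtain ⟨f, hfI, hfn⟩ : ∃ f ∈ stalkIdeal I y, f ∉ maximalIdeal (Y.presheaf.stalk y) ^ (n + 1) := by
    by_contra h
    push Not at h
    exact hnle fun f hf => h f hf
  obtain ⟨c, hc, had⟩ := exists_rsop_forall_ne_zero_isAdapted_of_stalkTau_eq_one I y hd hτ
  have hτc : hironakaTauAt c (stalkIdeal I y) n = 1 := by rw [← stalkTau_eq I y n hd c hc]; exact hτ
  obtain ⟨F, hF, hFf⟩ := exists_isHomogeneous_eval_eq_of_mem_pow c hc (hle hfI)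
  have hG : MvPolynomial.map (residue _) F ∈ initialForms c (stalkIdeal I y) n :=
    ⟨F, hF, by rw [hFf]; exact hfI, rfl⟩
  obtain ⟨a, ha⟩ := forall_initialForms_eq_C_mul_X_pow_of_isAdapted c hτc had _ hG
  obtain ⟨a', rfl⟩ := residue_surjective a
  -- `f − a'·(c 0)^n ∈ 𝔪^{n+1}`
  have hF' : (F - C a' * X (0 : Fin 3) ^ n).IsHomogeneous n := hF.sub (isHomogeneous_C_mul_X_pow a' 0 n)
  have hres : MvPolynomial.map (residue _) (F - C a' * X (0 : Fin 3) ^ n) = 0 := by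
    rw [map_sub, ha, map_mul, map_C, map_pow, map_X, sub_self]
  have hdiff : f - a' * c 0 ^ n ∈ maximalIdeal (Y.presheaf.stalk y) ^ (n + 1) := by
    have h := eval_mem_pow_succ_of_map_residue_eq_zero c hc hF' hres
    rwa [map_sub, hFf, map_mul, eval_C, map_pow, eval_X] at h
  have hc0 : c 0 ∈ maximalIdeal (Y.presheaf.stalk y) := by
    rw [← hc]; exact Ideal.subset_span ⟨0, rfl⟩
  -- `a'` is a unit: otherwise `f ∈ 𝔪^{n+1}`
  have ha' : IsUnit a' := by
    by_contra hna
    have hmem : a' * c 0 ^ n ∈ maximalIdeal (Y.presheaf.stalk y) ^ (n + 1) := by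
      rw [pow_succ']
      exact Ideal.mul_mem_mul ((mem_maximalIdeal _).mpr hna) (Ideal.pow_mem_pow hc0 n)
    exact hfn (by simpa using (Ideal.add_mem _ hdiff hmem))
  -- `c 0 ∉ 𝔪²`: otherwise `(c 0)^n ∈ 𝔪^{2n} ⊆ 𝔪^{n+1}` and again `f ∈ 𝔪^{n+1}`
  have hc0sq : c 0 ∉ maximalIdeal (Y.presheaf.stalk y) ^ 2 := by
    intro h2
    have hmem : a' * c 0 ^ n ∈ maximalIdeal (Y.presheaf.stalk y) ^ (n + 1) := by
      refine Ideal.mul_mem_left _ a' (Ideal.pow_le_pow_right (show n + 1 ≤ 2 * n by omega) ?_)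
      rw [pow_mul]
      exact Ideal.pow_mem_pow h2 n
    exact hfn (by simpa using (Ideal.add_mem _ hdiff hmem))
  exact ⟨c 0, hc0, hc0sq, f, hfI, a', ha', hdiff⟩

variable {k : Type} [Field k]

/-- **`τ(x_i) = 1` ⇒ PLANE CONE AT `x_i`** for a forced tower of ring dimension 3 (weight `n ≥ 1`). [folklore] -/
theorem planeConeAt_of_towerTau_eq_one (T : ForcedTower) (g : T.St 0 ⟶ Spec (.of k)) (hB : IsBase (T.St 0) g) {n : ℕ}
    (hn : 1 ≤ n) (hD : IsDatum n (T.D 0)) (h3 : ThreefoldTower T) (i : ℕ) (hτ : towerTau T g hB n i = 1) :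
    PlaneConeAt (T.D i).ideal n (T.pt i) := by
  haveI := tower_isRegular T g hB i (T.pt i)
  exact planeConeAt_of_stalkTau_eq_one (T.D i).ideal hn (T.pt i) (tower_spanFinrank_eq_three T g hB h3 i)
    (tower_idealOrder_pt_eq T g hB hD i) hτ

/-- **`TauOneTower ⇒ PlaneConeTower`** in ring dimension 3 (weight `n ≥ 1`; over a base). [folklore] -/
theorem planeConeTower_of_tauOneTower (T : ForcedTower) (g : T.St 0 ⟶ Spec (.of k)) (hB : IsBase (T.St 0) g) {n : ℕ}
    (hn : 1 ≤ n) (hD : IsDatum n (T.D 0)) (h3 : ThreefoldTower T) (hτ : TauOneTower n T) : PlaneConeTower n T := fun i =>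
  planeConeAt_of_towerTau_eq_one T g hB hn hD h3 i ((tauOneTower_iff_towerTau T g hB n).mp hτ i)

/-- **LAW A + KERNEL B: EVERY forced tower of ring dimension 3 has a RATIONAL PLANE CONE AT EVERY MARKED POINT** — as a
termination statement: the class «threefold ∧ ¬ PlaneConeTower» is EMPTY (every `p`, field, class, `n ≥ 1`). [folklore] -/
theorem noTower_threefold_not_planeCone {n : ℕ} (hn : 1 ≤ n) (P : ForcedTower → Prop) :
    NoTower n fun T => P T ∧ ThreefoldTower T ∧ ¬ PlaneConeTower n T := by
  intro p hp K _ _ T g hB hD hE hT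
  obtain ⟨hP, h3, hcone⟩ := hT
  by_cases hτ : TauOneTower n T
  · exact hcone (planeConeTower_of_tauOneTower T g hB hn hD h3 hτ)
  · exact noTower_threefold_not_tauOne hn P p hp K T g hB hD hE ⟨hP, h3, hτ⟩

end TauOneCone

section CurveLike

variable {k : Type} [Field k]

/-! ## §96 (g32 · NEW · KERNEL) LAW C — THE CURVE-LIKE LAW: in ring dimension 3, NO forced tower whose marked ideals
are ideals of
CURVES (zero loci of codimension `≥ 2` at every stage) — every `p`, every field, every class, every weight `n ≥ 1`.

PROOF.  By Law A the tower has `τ ≡ 1`; an infinite chain of `τ = 1` near points of the closed-point blow-ups, over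
isolated points of
`{ord ≥ n} = {ord = n}` (`tower_isDatum`: `ord ≤ n` everywhere; `isolated`), of G-ring local rings of embedding
dimension 3, with
`V(𝓘_i)` of codimension `≥ 2`, is exactly what Cossart–Piltant's Prop. 4.4, case `τ = 1` (proof p. 11: the adapted parameters
`(y⁽ⁿ⁾, u₁⁽ⁿ⁾, u₂⁽ⁿ⁾)` converge to a formal regular parameter `ŷ` with `𝓘·𝒪̂ ⊆ (ŷ)^n + …`, so the formal
hypersurface `V(ŷ)` would lie in
`V(𝓘)` — codimension 1, contradiction) forbids: the tree theorem `CP2008Prop44.stub_T1` (PROVED: `T1_of_N2full'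
false_of_fullChain_tau_one'`,
standard axioms), every binder of which is discharged from the tower exactly as in Law A (centres `Y_i = {x_i}`
reduced closed points:
irreducible, regular one-point subschemes; `hcoinc` = isolation; `hbd` = `tower_isDatum`). -/

/-- **`CurveLikeTower T` — THE THIRD CUT LETTER (NEW TYPED PREDICATE)**: at EVERY stage, EVERY point of the zero
locus `V(𝓘_i)` has
codimension `≥ 2` (`1 < coheight` in the specialisation order, whose top is the generic point): `𝓘_i` is the ideal
of a subscheme of
dimension `≤ 1` of the threefold stage — no divisorial component anywhere (in particular the root stalk is not a
hypersurface).  The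
binder is the `hcodim` binder of the tree's `CP2008Prop44.stub_T1` VERBATIM; it is GLOBAL on each stage (the
tower-restriction kernel
that would localise it at `x_i`, and the persistence kernel «curve-like at the root ⇒ at every stage», are NEXT-g33's). -/
def CurveLikeTower (T : ForcedTower) : Prop :=
  ∀ i, ∀ z ∈ ((T.D i).ideal).support, 1 < Order.coheight z

/-- **LAW C — THE CURVE-LIKE LAW (KERNEL, PROVED; every `p`, every field, every class `P`, every weight `n ≥ 1`): NO
forced tower of
ring dimension 3 is curve-like.**  (Sources: CossartPiltant2008, Prop. 4.4 (proof p. 11), Lemma 4.3 (1), (3), (5);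
Matsumura1987, Cor. of
Thm. 32.6; tree `CP2008Prop44.stub_T1`, `false_of_nearChain_tau_two`.) -/
theorem noTower_threefold_curveLike {n : ℕ} (hn : 1 ≤ n) (P : ForcedTower → Prop) :
    NoTower n fun T => P T ∧ ThreefoldTower T ∧ CurveLikeTower T := by
  intro p hp K _ _ T g hB hD hE hT
  obtain ⟨hP, h3, hcurve⟩ := hT
  by_cases hτ1 : TauOneTower n T
  swap
  · exact noTower_threefold_not_tauOne hn P p hp K T g hB hD hE ⟨hP, h3, hτ1⟩
  have hNR := tower_isLocallyNoetherian_isRegular T g hB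
  haveI : ∀ i, IsLocallyNoetherian (T.St i) := fun i => (hNR i).1
  have hτ := (tauOneTower_iff_towerTau T g hB n).mp hτ1
  exact CP2008Prop44.stub_T1 T.St (fun i => (hNR i).1) (tower_isRegular T g hB) T.π
    (fun i => ⟨{(T.π i).base (T.pt (i + 1))}, tower_isClosed_base T i⟩) (fun i => T.pt (i + 1))
    (fun i => (T.D i).ideal) hn (fun i => T.pt_map (i + 1)) (fun i => Set.mem_singleton _)
    (fun i => tower_isClosed_base T i) (fun i => isIrreducible_singleton)
    (fun i => CampaignW46.isRegular_subscheme_vanishingIdeal_singleton (tower_isClosed_base T i))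
    (fun i z hz => by
      have hz' : z = (T.π i).base (T.pt (i + 1)) := Set.mem_singleton_iff.mp hz
      rw [hz', T.pt_map]
      exact tower_idealOrder_pt_eq T g hB hD i)
    (fun i => tower_isBlowup_base T i) (fun i => tower_ideal_succ_eq_controlledTransform_base T hD i)
    (fun i z => (tower_isDatum T g hB hD i).2 z) hcurve
    (fun i => tower_spanFinrank_eq_three_base T g hB h3 i) (fun i => tower_isNear_base T g hB hD i)
    (fun i => by
      have h := hτ i
      unfold towerTau at h
      rwa [CampaignW46.stalkTau_congr (tower_isRegular T g hB i) (T.D i).ideal n (T.pt_map i).symm] at h)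
    (fun i => tower_isGRing_stalk T g hB i _)
    (fun i z hz hord => by
      show z ∈ ({(T.π i).base (T.pt (i + 1))} : Set (T.St i))
      rw [Set.mem_singleton_iff]
      by_contra hne
      rw [T.pt_map] at hz hne
      exact tower_not_le_idealOrder_of_specializes T hD i z hz hne hord.ge)

/-- **LAW C on the wild column** (`p ∣ n`, `n ≥ 1`). [folklore] -/
theorem noTowerWild_threefold_curveLike {n : ℕ} (hn : 1 ≤ n) (P : ForcedTower → Prop) :
    NoTowerWild n fun T => P T ∧ ThreefoldTower T ∧ CurveLikeTower T := by
  intro p hp hpn K _ _ T g hB hD hE hT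
  exact noTower_threefold_curveLike hn P p hp K T g hB hD hE hT

end CurveLike

end Summit.ResolutionOfSingularities.ResolutionOfSingularities.Theorems.HugValuationCut
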